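import Literature.Computability.QuantumComplexity.GRStagePlaced
import Literature.Computability.QuantumComplexity.CleanXorAbstract
import HarnessLib

/-!
# The abstract gate list of the Grover–Rudolph block (`GRStage.blockCircuit`)

Topic `Literature/Computability/QuantumComplexity`; a companion of `GRStagePlaced.lean` for UNIFORMITY proofs in the
abstract-gate-list style of `CoreDescAbstract.lean` (a circuit family is uniform as soon as the abstract gate lists
`gates.map toAG` of its circuits are computed on codes, `AbstractGateUniform.lean`). The Grover–Rudolph block of Regev's
sampler is `chainCircuit` of its levels, level `j` being `[CleanPlaced.circuitRev _, grWord _, CleanPlaced.circuit _]`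
(compute the cosine field, rotate by the OAA word, uncompute). We prove the SHAPE of its abstract word from the already
abstracted pieces (`map_toAG_revCompile_toRevList`, `map_toAG_oaaWordCircuit`, `map_toAG_sandwichCircuit`,
`map_toAG_reflectCircuit` of `CoreDescAbstract.lean`; `CleanPlaced.map_val_placedOps` of `CleanXorAbstract.lean`):

* `CleanPlaced.map_toAG_circuit`, `CleanPlaced.map_toAG_circuitRev` — the placed clean block (and its reverse) abstract
  to `progA` of `cleanOps` re-indexed by `relabel n₀ dpos base` (resp. of its reverse);
* `GRWord.map_toAG_grWord` — the level rotation abstracts to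
  `oaaWordA (sandwichA had cr t ((grOps kit t fs).map (ClOp.map Fin.val)) [] [grFlag]) (reflectA cr (as ++ region) hs)`;
* **`GRStage.levelA`, `GRStage.map_toAG_levelCircuit`, `GRStage.map_toAG_blockCircuit`** — the block's word is
  `(List.finRange ℓ).flatMap levelA`, `levelA j = P j ++ (W j ++ Pʳ j)` with `P j` the placed clean block's word of
  level `j`, `W j` the rotation word and `Pʳ j` the word of the reversed placed program.

What remains for the uniformity of the stage is to compute `(grOps kit t fs).map (ClOp.map Fin.val)` and the kit's wire
lists on codes for the sampler's concrete kit (as `CoreDescAbstract.BP` does for the AJL kit). Everything is proved; no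
named fact is introduced.

## References

* O. Regev, *On lattices, learning with errors, random linear codes, and cryptography*, J. ACM 56(6) (2009), Lemma 3.12
  (proof), Lemma 3.14 (proof) [Regev2009].
* L. Grover, T. Rudolph, *Creating superpositions that correspond to efficiently integrable probability distributions*,
  arXiv:quant-ph/0208112 (2002), eq. (5) [GroverRudolph2002].
* S. Arora, B. Barak, *Computational Complexity: A Modern Approach*, CUP 2009, §6.2 and proof of Thm. 6.15
  [AroraBarak2009].
-/

noncomputable section

namespace Literature.Computability.QuantumComplexity

open _root_.Computability Complexity Turing RevSim RevClean AJLCore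

/-! ### The placed clean block -/

namespace CleanPlaced

variable {N : ℕ} {hN : 0 < N} {e : ℕ} {M : TM2ComputableAux Bool Bool} {n₀ : ℕ} {v : List Bool} {dpos : ℕ → ℕ} {base : ℕ}
  (G : GeomOK N e M n₀ v dpos base)
include G

/-- **The abstract gate list of the placed clean block.** [cite: AroraBarak2009, §6.2 and proof of Thm. 6.15] -/
theorem map_toAG_circuit : (circuit G (hN := hN)).gates.map toAG = progA ((cleanOps e M n₀ v).map (ClOp.map (relabel n₀ dpos base))) := by
  show (revCompile (toRevList (placedOps hN e M n₀ v dpos base) _)).map toAG = _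
  rw [map_toAG_revCompile_toRevList, map_val_placedOps G]

/-- **The abstract gate list of the placed clean block reversed** (a reversed PROGRAM, not a reversed word).
[cite: AroraBarak2009, §6.2 and proof of Thm. 6.15] -/
theorem map_toAG_circuitRev :
    (circuitRev G (hN := hN)).gates.map toAG = progA ((cleanOps e M n₀ v).map (ClOp.map (relabel n₀ dpos base))).reverse := by
  show (revCompile (toRevList (placedOps hN e M n₀ v dpos base).reverse _)).map toAG = _
  rw [map_toAG_revCompile_toRevList, List.map_reverse, map_val_placedOps G]

end CleanPlaced

/-! ### The level rotation -/

namespace GRWord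

variable {N : ℕ} {kit : GadgetKit N} (hk : kit.OK) {t : Fin N} {fs : Fin kit.k ↪ Fin N} (hW : WiresOK kit t fs) (hP : ProgOK kit)

/-- **The abstract gate list of the level rotation**: the OAA word of the flag sandwich and the kit's reflection.
[cite: GroverRudolph2002, eq. (5)] [cite: AroraBarak2009, §6.2 and proof of Thm. 6.15] -/
theorem map_toAG_grWord : (grWord hk hW hP).gates.map toAG =
    oaaWordA (sandwichA ((kit.cr :: kit.as).map Fin.val) kit.cr t ((grOps kit t fs).map (ClOp.map Fin.val)) [] [(grFlag kit t fs : ℕ)])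
      (reflectA kit.cr ((kit.as ++ kit.region).map Fin.val) (kit.hs.map Fin.val)) := by
  rw [grWord, map_toAG_oaaWordCircuit, map_toAG_sandwichCircuit, map_toAG_reflectCircuit]
  rfl

end GRWord

/-! ### The block -/

namespace GRStage

open GRWord

variable {B ℓ np : ℕ} {kit : GadgetKit B} {ws : Fin ℓ ↪ Fin B} {pw : Fin np ↪ Fin B} {a : Fin ℓ → (Fin ℓ → Bool) → ℝ}
  (D : GRBlock.Data kit ws pw a)

/-- **The abstract word of level `j`**: placed clean block, rotation word, reversed placed program.
[cite: Regev2009, Lemma 3.12 (proof)] -/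
def levelA (j : Fin ℓ) : List AG :=
  progA ((cleanOps D.e D.M (j + np) (D.v j)).map (ClOp.map (CleanPlaced.relabel (j + np) (GRBlock.dposP ws pw j) D.base))) ++
    (oaaWordA (sandwichA ((kit.cr :: kit.as).map Fin.val) kit.cr (ws j) ((grOps kit (ws j) (GRWord.fsEmb (D.hG j))).map (ClOp.map Fin.val)) []
        [(grFlag kit (ws j) (GRWord.fsEmb (D.hG j)) : ℕ)]) (reflectA kit.cr ((kit.as ++ kit.region).map Fin.val) (kit.hs.map Fin.val)) ++
      progA ((cleanOps D.e D.M (j + np) (D.v j)).map (ClOp.map (CleanPlaced.relabel (j + np) (GRBlock.dposP ws pw j) D.base))).reverse)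

/-- **The abstract gate list of a level.** [cite: Regev2009, Lemma 3.12 (proof)]
[cite: AroraBarak2009, §6.2 and proof of Thm. 6.15] -/
theorem map_toAG_levelCircuit (j : Fin ℓ) : (levelCircuit D j).gates.map toAG = levelA D j := by
  rw [levelCircuit, gates_chainCircuit]
  simp only [List.reverse_cons, List.reverse_nil, List.nil_append, List.flatMap_append, List.flatMap_cons, List.flatMap_nil,
    List.append_nil, List.map_append, CleanPlaced.map_toAG_circuit, CleanPlaced.map_toAG_circuitRev, map_toAG_grWord, levelA,
    List.append_assoc]

/-- **The abstract gate list of the Grover–Rudolph block**: the level words, level `0` first.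
[cite: Regev2009, Lemma 3.12 (proof)] [cite: AroraBarak2009, §6.2 and proof of Thm. 6.15] -/
theorem map_toAG_blockCircuit : (blockCircuit D).gates.map toAG = (List.finRange ℓ).flatMap (levelA D) := by
  rw [blockCircuit, gates_chainCircuit, List.reverse_reverse, List.map_flatMap, List.ofFn_eq_map, List.flatMap_map]
  exact List.flatMap_congr fun j _ => map_toAG_levelCircuit D j

end GRStage

end Literature.Computability.QuantumComplexity

end
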